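import Summits.QuantumFields.YangMills.Theorems.UnitScaleTiltProp7OneFormConjugateResolventPhaseClass
import Summits.QuantumFields.YangMills.Theorems.UnitScaleTiltProp7OneFormGreenKFreeNumerics
import Summits.QuantumFields.YangMills.Theorems.UnitScaleTiltProp7OneFormRemainderFloorOfLift
import Summits.QuantumFields.YangMills.Theorems.UnitScaleTiltProp7OneFormCoerciveHolds
import HarnessLib

/-!
# Route `UnitScaleTilt`, crux K1 «MinimiserStabilityRegPr» (stmt-QuantumFields-19200), EX rows `h137kπ` ∕ `h137kΔ` ∕ `hCk` — **K-STOREY BRICK (K2b-δ₃)-D′ (px12 g17): THE `δ₃` CLASS LETTER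
# WITH K-FREE CONSTANTS, UNDER LIFT** — (K2b-δ₃)-D ✓p769533 `conj_resolvent_oneForm_phaseClass` with its five displayed letters DISCHARGED∕MAJORISED member-uniformly, px16 g13's D2 (b) pattern
# token for token: (γ) `hco` stays displayed (⟸ ✓`hco_DeltaEtaSlot_exists`, `γco L`); `PosOnto` ⟸ ✓`posOnto_of_coercive`; (C_V) ⟸ px21 ✓`hVlow_abs_of_lift` majorised by the absolute
# `C_V¹ = 32√2·648 + (33∕8)²·600·(27∕4)⁶` (✓`CV_abs_le`); `hQ` ⟸ ✓`norm_Qk_le_of_regPr` (`C_Q = 6√(cB∕c₀)√(ℓ⁻³)`); `hk` = the h349 kernel text in the ℓ⁻³ scaling (`Ck = C_K·ℓ⁻³`, rate `δ_K`,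
# displayed — the family ✓`kernelRow349_allMembers_exists` inhabits it); `θ_r := r·T(a₁, C_K, δ_K) + 10⁵ε₀` by ✓`thetaV_le_kfree`; `Θ ≥ γ∕2 > 0` by the four quarter-budgets
# ✓`theta_ge_half_of_budgets`.  RESULT: px10 g13's `hres` with **`δ₃ = Δ₃(γ, C_K, δ_K, a₁, r, ε, ε₀)` — NO `K`, NO `ℓ`** (the (R_L) window of ✓p768818 §3 then reads L-only numbers).

Cell `ym3-torus` (HUMAN RULING D-0037: SU(2) YM₃ on T³ is ladder rung R3 — NOT d = 4, NOT infinite volume, NOT a mass gap, NOT Clay).  Width seat `ym3-torus-px12` gen 17.  THEOREMS ONLY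
(0 `def`, 0 `sorry`, default heartbeats); `--supports stmt-QuantumFields-19200 --as helper`, count-neutral.  HONEST LABEL: composition of landed theorems + px16's numerics; CONDITIONAL on `Lift`,
(γ) and the h349 kernel row `hk`; the `10⁵ε₀` share of `θ_r` is the CRUDE (L) piece of B2 (so `δ₃ ↛ 0` as `r → 0` at fixed `ε₀` — the knit's (R_L) must also cap `ε₀`); nothing of (3.132), `h137kπ`,
`h137kΔ`, `hCk`, EX or 19200 is proved here.

WHAT IS PROVED (ns `Summit.QuantumFields.YangMills.Theorems.Prop7OneFormConjugateResolventKFree`; member `F`, `h : n ≤ K`, weights `c₀ cB`, coupling `a`).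
* `sq_sqrt3_mul` (`(√3·r·e^{r})² = 3(r²e^{2r})`), ★★★ `conj_resolvent_oneForm_phaseClass_kfree` — THE THEOREM ABOVE.
HYP-SAT (★★OWNER RULING №42): exactly px16 D2 (b) ✓∕⧗`blockColumn_GT_DeltaEtaSlot_kfree`'s hypothesis list (windows, `Lift`, coupling window, (γ), `hkD`, the budgets `r ≤ ¼`, `r ≤ δ_K∕2`,
`ε ≤ ⅛`, `εC_V¹ ≤ γ∕8`, `r ≤ γε∕48`, `rT ≤ γ∕16`, `10⁵ε₀ ≤ γ∕16` — all inhabited by L-only choices as in px16's (c)); nothing eventual; no restatement.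

References: T. Bałaban, CMP **99** (1985) 389–434 [Balaban1985BackgroundPropagators] (Thm 3.1 (3.46)–(3.49) pp.398–399, Thm 3.11 p.416, (3.132) p.422); S. Agmon, *Lectures on exponential
decay* (Princeton 1982) Ch. 1 [Agmon1982].
-/

set_option autoImplicit false

noncomputable section

open scoped BigOperators Matrix.Norms.L2Operator InnerProductSpace ComplexConjugate

namespace Summit.QuantumFields.YangMills.Theorems.Prop7OneFormConjugateResolventKFree

open Literature.MathematicalPhysics.QuantumFieldTheory.Balaban1983to89
open Literature.MathematicalPhysics.QuantumFieldTheory.Balaban1983to89.T3ContinuumYM3Torus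
open T3SectALandauChart (eta eta_pos bgUnits formComp)
open T3PrintedRegularMinimiser (RegPr)
open B11Eq103H1Complex (SiteL2K BondL2K)
open B5Eq118OneStroke (iterBlockOf)
open B15DeterminingSets (embIter)
open Summit.QuantumFields.YangMills.Theorems.Prop8Chart (emlIterU)
open Summit.QuantumFields.YangMills.Theorems.Prop7SectET3Transport (periodsT3)
open Summit.QuantumFields.YangMills.Theorems.Prop7SectET3HilbertLetters (W₂ toL2 toL2S DL2 DstarL2)
open Summit.QuantumFields.YangMills.Theorems.Prop7SectET3WilsonHessian (DeltaEta DeltaEtaSlot)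
open Summit.QuantumFields.YangMills.Theorems.Prop7SectET3GaugeProjector (RS)
open Summit.QuantumFields.YangMills.Theorems.Prop7SectET3CurvedPropagators (laplaceA Qk GT PosOnto)
open Summit.QuantumFields.YangMills.Theorems.Prop7QkAdjointSupRowOfRegPr (norm_Qk_le_of_regPr)
open Summit.QuantumFields.YangMills.Theorems.Prop7OneFormCoerciveHolds (posOnto_of_coercive)
open Summit.QuantumFields.YangMills.Theorems.Prop7OneFormRemainderFloorOfLift (hVlow_abs_of_lift)
open Summit.QuantumFields.YangMills.Theorems.Prop7OneFormGreenKFreeNumerics (thetaV_le_kfree CV_abs_le rbudget_le theta_ge_half_of_budgets)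
open Summit.QuantumFields.YangMills.Theorems.Prop7OneFormConjugateResolventPhaseClass (conj_resolvent_oneForm_phaseClass)

variable (F : T3Family) {n K : ℕ} (h : n ≤ K) (c₀ cB : ℝ) [Fact (0 < c₀)] [Fact (0 < cB)] {a : ℝ}

omit [Fact (0 < c₀)] [Fact (0 < cB)] in
/-- `(√3·r·e^{r})² = 3·(r²·e^{2r})` (the gradient-defect majorant of (K2b-δ₃)-D in px16's budget currency). [folklore] -/
theorem sq_sqrt3_mul (r : ℝ) : (Real.sqrt 3 * r * Real.exp r) ^ 2 = 3 * (r ^ 2 * Real.exp (2 * r)) := by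
  have e3 : Real.sqrt 3 ^ 2 = 3 := Real.sq_sqrt (by norm_num)
  have e2 : Real.exp r ^ 2 = Real.exp (2 * r) := by rw [← Real.exp_nat_mul]; norm_num
  calc (Real.sqrt 3 * r * Real.exp r) ^ 2 = Real.sqrt 3 ^ 2 * r ^ 2 * Real.exp r ^ 2 := by ring
    _ = 3 * (r ^ 2 * Real.exp (2 * r)) := by rw [e3, e2]; ring

/-- ★★★ **THE `δ₃` CLASS LETTER WITH K-FREE CONSTANTS, UNDER LIFT.**  Member `F`, `n < K`; `RegPr F n K ε₀ U₀` with the windows `10¹²L³ε₀ ≤ 1`, `10¹⁰L⁶ε₀ ≤ 1`, `13·10¹⁴L³ε₀ ≤ 1`; the Lift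
antecedent; coupling `0 ≤ a ≤ a₁(c₀∕cB)ℓ³`; (γ) `hco` at the slot of record (`0 < γ`); the h349 kernel row `hkD` with `Ck = C_K·ℓ⁻³`, rate `δ_K`; the budgets `0 < r ≤ ¼`, `r ≤ δ_K∕2`, `0 < ε ≤ ⅛`,
`ε·C_V¹ ≤ γ∕8`, `r ≤ γε∕48`, `r·T ≤ γ∕16` (`T = 5000a₁ + 27√2·C_K·(2(1+4∕δ_K))³∕min 1 (δ_K∕4)`), `10⁵ε₀ ≤ γ∕16`.  THEN px10 g13's `hres` holds on the phase class of slope `r·η`: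
`∀ φ (|φ x − φ x′| ≤ rη·tdist), ∀ M_f M_fi (rows), ∀ x, ‖M_f(G_T(M_fi x)) − G_T x‖ ≤ δ₃·‖x‖` with `δ₃ = Δ₃(γ, r, ε, θ_r)`, `θ_r := r·T + 10⁵ε₀`, `C_V := C_V¹`, `d₁ = √3·r·e^{r}`, as displayed —
every symbol K-free. [cite: Balaban1985BackgroundPropagators, Thm 3.1 (3.46)–(3.49) pp.398–399, Thm 3.11 p.416, (3.132) p.422; Agmon1982, Ch. 1] -/
theorem conj_resolvent_oneForm_phaseClass_kfree (hnK : n < K) {ε₀ : ℝ} (hε₀ : 0 < ε₀) (hWε : 10 ^ 12 * (F.L : ℝ) ^ 3 * ε₀ ≤ 1)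
    (hε10 : 10 ^ 10 * (F.L : ℝ) ^ 6 * ε₀ ≤ 1) (hwin : 13 * 10 ^ 14 * (F.L : ℝ) ^ 3 * ε₀ ≤ 1)
    (U₀ : GaugeField (F.P K) 0 (Matrix.specialUnitaryGroup (Fin 2) ℂ)) (hreg : RegPr F n K ε₀ U₀)
    (hlift : ∀ cf : Site (F.P K) (K - n) → Matrix (Fin 2) (Fin 2) ℂ,
        (∀ e : PBond (F.P K) (K - n), cf e.src = ((emlIterU (K - n) (bgUnits F K U₀) e : (Matrix (Fin 2) (Fin 2) ℂ)ˣ) : Matrix (Fin 2) (Fin 2) ℂ) * cf e.tgt *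
          (((emlIterU (K - n) (bgUnits F K U₀) e)⁻¹ : (Matrix (Fin 2) (Fin 2) ℂ)ˣ) : Matrix (Fin 2) (Fin 2) ℂ)) →
        ∃ l₀ : Site (F.P K) 0 → Matrix (Fin 2) (Fin 2) ℂ,
          (∀ b : PBond (F.P K) 0, l₀ b.src = ((bgUnits F K U₀ b : (Matrix (Fin 2) (Fin 2) ℂ)ˣ) : Matrix (Fin 2) (Fin 2) ℂ) * l₀ b.tgt * (((bgUnits F K U₀ b)⁻¹ : (Matrix (Fin 2) (Fin 2) ℂ)ˣ) : Matrix (Fin 2) (Fin 2) ℂ)) ∧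
          ∀ y : Site (F.P K) (K - n), l₀ (embIter (K - n) y) = cf y)
    {a₁ : ℝ} (ha : 0 ≤ a) (ha₁ : a ≤ a₁ * (c₀ / cB) * ((F.L : ℝ) ^ (K - n)) ^ 3)
    {γ : ℝ} (hγ : 0 < γ) (hco : ∀ v : BondL2K ℂ 3 (periodsT3 F K) c₀ W₂, γ * ‖v‖ ^ 2 ≤ RCLike.re ⟪v, laplaceA F n K h c₀ cB a (DeltaEtaSlot F n K c₀) U₀ v⟫_ℂ)
    {CK δK : ℝ} (hCK : 0 ≤ CK) (hδK : 0 < δK)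
    (hkD : ∀ (b : PBond (F.P K) 0) (Z : Matrix (Fin 2) (Fin 2) ℂ) (bd : PBond (F.P K) 0),
      ‖(toL2 F K c₀).symm (DL2 F n K c₀ U₀ (DstarL2 F n K c₀ U₀ (toL2 F K c₀ (Pi.single b Z))
          - RS F n K h c₀ cB U₀ (DstarL2 F n K c₀ U₀ (toL2 F K c₀ (Pi.single b Z))))) bd‖
        ≤ CK * ((F.L : ℝ) ^ (K - n))⁻¹ ^ 3 * Real.exp (-(δK * (Site.tdist (P := F.P K) (iterBlockOf (K - n) b.src) (iterBlockOf (K - n) bd.src) : ℝ))) * ‖Z‖)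
    {r ε : ℝ} (hr : 0 < r) (hr4 : r ≤ 1 / 4) (hrδ : r ≤ δK / 2) (hε : 0 < ε) (hε8 : ε ≤ 1 / 8)
    (hεC : ε * (32 * Real.sqrt 2 * 648 + (33 / 8 : ℝ) ^ 2 * (600 * (27 / 4 : ℝ) ^ 6)) ≤ γ / 8) (hrγ : r ≤ γ * ε / 48)
    (hrT : r * (5000 * a₁ + 27 * Real.sqrt 2 * CK * (2 * (1 + 4 / δK)) ^ 3 / min 1 (δK / 4)) ≤ γ / 16) (hαγ : 10 ^ 5 * ε₀ ≤ γ / 16) :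
    ∀ φ : Site (F.P K) 0 → ℝ, (∀ x x' : Site (F.P K) 0, |φ x - φ x'| ≤ r * eta F n K * (Site.tdist x x' : ℝ)) →
    ∀ (Mf Mfi : BondL2K ℂ 3 (periodsT3 F K) c₀ W₂ →ₗ[ℂ] BondL2K ℂ 3 (periodsT3 F K) c₀ W₂),
      (∀ X : PBond (F.P K) 0 → Matrix (Fin 2) (Fin 2) ℂ, Mf (toL2 F K c₀ X) = toL2 F K c₀ (fun b => Real.exp (φ b.src) • X b)) →
      (∀ X : PBond (F.P K) 0 → Matrix (Fin 2) (Fin 2) ℂ, Mfi (toL2 F K c₀ X) = toL2 F K c₀ (fun b => (Real.exp (φ b.src))⁻¹ • X b)) →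
    ∀ x : BondL2K ℂ 3 (periodsT3 F K) c₀ W₂,
      ‖Mf (GT F n K h c₀ cB a (DeltaEtaSlot F n K c₀) U₀ (Mfi x)) - GT F n K h c₀ cB a (DeltaEtaSlot F n K c₀) U₀ x‖
        ≤ (Real.sqrt γ)⁻¹ * ((Real.sqrt 3 * r * Real.exp r) * Real.sqrt (1 + (32 * Real.sqrt 2 * 648 + (33 / 8 : ℝ) ^ 2 * (600 * (27 / 4 : ℝ) ^ 6)) / γ)
                * ((1 - ε) * γ - ε * (32 * Real.sqrt 2 * 648 + (33 / 8 : ℝ) ^ 2 * (600 * (27 / 4 : ℝ) ^ 6)) - (Real.sqrt 3 * r * Real.exp r) ^ 2 * (1 + 1 / ε)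
                    - (r * (5000 * a₁ + 27 * Real.sqrt 2 * CK * (2 * (1 + 4 / δK)) ^ 3 / min 1 (δK / 4)) + 10 ^ 5 * ε₀))⁻¹
            + (Real.sqrt 3 * r * Real.exp r) * (Real.sqrt γ)⁻¹
                * Real.sqrt ((((1 - ε) * γ - ε * (32 * Real.sqrt 2 * 648 + (33 / 8 : ℝ) ^ 2 * (600 * (27 / 4 : ℝ) ^ 6)) - (Real.sqrt 3 * r * Real.exp r) ^ 2 * (1 + 1 / ε)
                      - (r * (5000 * a₁ + 27 * Real.sqrt 2 * CK * (2 * (1 + 4 / δK)) ^ 3 / min 1 (δK / 4)) + 10 ^ 5 * ε₀))⁻¹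
                    + ((Real.sqrt 3 * r * Real.exp r) ^ 2 * (1 + 1 / ε) + (32 * Real.sqrt 2 * 648 + (33 / 8 : ℝ) ^ 2 * (600 * (27 / 4 : ℝ) ^ 6))
                        + (r * (5000 * a₁ + 27 * Real.sqrt 2 * CK * (2 * (1 + 4 / δK)) ^ 3 / min 1 (δK / 4)) + 10 ^ 5 * ε₀))
                      * ((1 - ε) * γ - ε * (32 * Real.sqrt 2 * 648 + (33 / 8 : ℝ) ^ 2 * (600 * (27 / 4 : ℝ) ^ 6)) - (Real.sqrt 3 * r * Real.exp r) ^ 2 * (1 + 1 / ε)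
                          - (r * (5000 * a₁ + 27 * Real.sqrt 2 * CK * (2 * (1 + 4 / δK)) ^ 3 / min 1 (δK / 4)) + 10 ^ 5 * ε₀))⁻¹ ^ 2)
                  / (1 - ε))
            + ((Real.sqrt 3 * r * Real.exp r) ^ 2 + (r * (5000 * a₁ + 27 * Real.sqrt 2 * CK * (2 * (1 + 4 / δK)) ^ 3 / min 1 (δK / 4)) + 10 ^ 5 * ε₀))
                * (Real.sqrt γ)⁻¹
                * ((1 - ε) * γ - ε * (32 * Real.sqrt 2 * 648 + (33 / 8 : ℝ) ^ 2 * (600 * (27 / 4 : ℝ) ^ 6)) - (Real.sqrt 3 * r * Real.exp r) ^ 2 * (1 + 1 / ε)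
                    - (r * (5000 * a₁ + 27 * Real.sqrt 2 * CK * (2 * (1 + 4 / δK)) ^ 3 / min 1 (δK / 4)) + 10 ^ 5 * ε₀))⁻¹) * ‖x‖ := by
  have hc₀ : 0 < c₀ := Fact.out
  have hcB : 0 < cB := Fact.out
  have hd : (F.P K).d = 3 := rfl
  have hL2 : (2 : ℝ) ≤ F.L := by exact_mod_cast F.hL.2
  have hLr : (1 : ℝ) ≤ F.L := le_trans one_le_two hL2
  have hL0 : (0 : ℝ) < F.L := lt_of_lt_of_le one_pos hLr
  have hℓ : (0 : ℝ) < (F.L : ℝ) ^ (K - n) := pow_pos hL0 _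
  have hε1 : ε₀ ≤ 1 := by
    have hL3 : (1 : ℝ) ≤ (F.L : ℝ) ^ 3 := one_le_pow₀ hLr
    have h1 : (1 : ℝ) ≤ 10 ^ 12 * (F.L : ℝ) ^ 3 := le_trans hL3 (le_mul_of_one_le_left (by positivity) (by norm_num))
    calc ε₀ = 1 * ε₀ := (one_mul _).symm
      _ ≤ 10 ^ 12 * (F.L : ℝ) ^ 3 * ε₀ := mul_le_mul_of_nonneg_right h1 hε₀.le
      _ ≤ 1 := hWε
  -- names
  set CV1 : ℝ := 32 * Real.sqrt 2 * 648 + (33 / 8 : ℝ) ^ 2 * (600 * (27 / 4 : ℝ) ^ 6) with hCV1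
  set T : ℝ := 5000 * a₁ + 27 * Real.sqrt 2 * CK * (2 * (1 + 4 / δK)) ^ 3 / min 1 (δK / 4) with hT
  set θr : ℝ := r * T + 10 ^ 5 * ε₀ with hθr_def
  -- PosOnto, C_Q, C_V
  have hp : PosOnto F n K h c₀ cB a (DeltaEtaSlot F n K c₀) U₀ := posOnto_of_coercive h cB hnK hreg hwin hγ (DeltaEtaSlot F n K c₀) hco
  have hQ := norm_Qk_le_of_regPr F h c₀ cB hε₀ hε10 hWε U₀ hreg
  have hCQ : 0 ≤ 6 * Real.sqrt (cB / c₀) * Real.sqrt (((F.L : ℝ) ^ (K - n))⁻¹ ^ 3) := by positivity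
  have hVlow₀ := hVlow_abs_of_lift F h c₀ cB hnK hε₀ hWε U₀ hreg ha hlift
  have hCVle : 32 * Real.sqrt 2 * ε₀ * (((F.P K).d : ℝ) * (2 * 3) ^ (F.P K).d) + (33 / 8 : ℝ) ^ 2 * (600 * (27 / 4 : ℝ) ^ 6) ≤ CV1 := by
    rw [hCV1]; exact CV_abs_le hd hε1
  have hVlow : ∀ X : PBond (F.P K) 0 → Matrix (Fin 2) (Fin 2) ℂ,
      -(CV1 * ‖toL2 F K c₀ X‖ ^ 2) ≤ RCLike.re ⟪toL2 F K c₀ X, laplaceA F n K h c₀ cB a (DeltaEtaSlot F n K c₀) U₀ (toL2 F K c₀ X)⟫_ℂ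
        - ∑ μ : Fin (F.P K).d, ‖DL2 F n K c₀ U₀ (toL2S F K c₀ (formComp X μ))‖ ^ 2 := fun X => by
    have h1 := hVlow₀ X
    have hX0 : 0 ≤ ‖toL2 F K c₀ X‖ ^ 2 := sq_nonneg _
    have h2 := mul_le_mul_of_nonneg_right hCVle hX0
    linarith
  have hCV1_0 : 0 ≤ CV1 := by rw [hCV1]; positivity
  -- θ_V(r) ≤ θ_r (px16 (E1))
  have hθ := thetaV_le_kfree hd hLr (K - n) hc₀ hcB ha ha₁ hCK hδK hr hr4 hrδ hε₀.le
  -- Θ ≥ γ∕2 > 0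
  have hR := (rbudget_le hγ.le hr hr4 hε (by linarith) hrγ).trans (show γ / 16 ≤ γ / 8 by linarith [hγ.le])
  have hθ8 : θr ≤ γ / 8 := by rw [hθr_def]; linarith
  have hΘhalf := theta_ge_half_of_budgets (CV := CV1) (θV := θr) hγ.le hε8 hεC hR hθ8
  have hΘ : 0 < (1 - ε) * γ - ε * CV1 - (Real.sqrt 3 * r * Real.exp r) ^ 2 * (1 + 1 / ε) - θr := by
    rw [sq_sqrt3_mul]; linarith
  -- the class letter of (K2b-δ₃)-D at `θ_r`, `C_V¹`, `μ′ := δ_K`, `Ck := C_K·ℓ⁻³`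
  have hrδ' : r < δK := by linarith
  have hmain := conj_resolvent_oneForm_phaseClass F h c₀ cB (a := a) hε₀ hε10 hWε U₀ hreg ha hp hr.le hrδ' (by positivity : 0 ≤ CK * ((F.L : ℝ) ^ (K - n))⁻¹ ^ 3) hkD hCQ hQ
    hγ hCV1_0 hε (by linarith) hco hVlow (θr := θr) (by rw [hθr_def]; exact hθ) hΘ
  exact hmain

end Summit.QuantumFields.YangMills.Theorems.Prop7OneFormConjugateResolventKFree

end
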